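import Literature.AnabelianGeometry.EtaleTheta.Discharge.Sec5RootChainStepModel
import Literature.AnabelianGeometry.EtaleTheta.Discharge.Sec5RootTransitionsModel

/-!
# [EtTh] Rmk. 4.3.2 «compatible systems of roots» at the canonical model, II: a cofinal chain of coverings with coherent roots,
# and a family of `N`-th roots for ALL `N ≥ 1` with the Rmk. 4.3.2 transitions for ALL `N ∣ N′` — from the base-level laws

Mochizuki, *The étale theta function and its Frobenioid-theoretic manifestations*, Publ. RIMS **45** (2009), Rmk. 4.3.2
pp. 318–319 (PDF pp. 92–93): «… by allowing `N` to vary, we obtain a compatible system of roots of the fraction-pair `(s′, s″)`»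
[cite: MochizukiEtTh2009, Rmk 4.3.2 p.318–319 (PDF pp.92–93)]; §5 p. 330 (PDF p. 104) («by considering compatible systems as in
Remark 4.3.2»).

abc-iut cell, layer L2, PROOF-ONLY companion (0 `def`s; seat abc-iut-w5-d134 gen 4) of this seat's `Sec5RootChainStepModel.lean`
and `Sec5RootTransitionsModel.lean`; consumer: abc-iut-L2-t4's `ThetaFrobenioidTower.ofBiKummerFamily` (p420398), whose INPUTS «a
FAMILY `R N` (`N ≥ 1`) of `N`-th root data» and «the Rmk. 4.3.2 TRANSITIONS `(α_{N,N′}, β_{N,N′})` with their printed properties»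
are PRODUCED here at the canonical model instance `S := mkOfModelCanonical X tf … A₀ …` modulo base-level laws only.  Nothing
landed is edited or restated.

* `exists_rootChain_mkOfModelCanonical` — from `hR` (ERRATUM-E2 root law, G-w4d044-3) and the multi-level refinement law `hEdiv`
  ([FrdII] Rmk. 2.2.1 at all divisors of a level; GAP G-w5d134g4-1 family form; arithmetic producer p437069): over a Frobenius-trivial
  `A` with Galois base in a skeleton through `A_⊙` and `f ∈ O^×(A^birat)`, a chain `A ← E₀ ← E₁ ← ⋯` of pull-back morphisms of
  Frobenius-trivial Galois objects with roots `g_k ∈ O^×(E_k^birat)`, `g_k^{(k+1)!} = φ_k^* f`, `g_{k+1}^{k+2} = ψ_k^* g_k` ON THE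
  NOSE (each step extracts a root of the previous root), `E_k` `μ_{l·(k+1)!}`-saturated with Def. 4.1 (iii)(a) at every level
  dividing `l·(k+1)!`, and the whole family `{A_⊙, A, E_0, E_1, …}` SKELETAL (`=` whenever the bases are isomorphic) — the chain
  is a `Nat.rec` over a history list with `Classical.choice` (`exists_refinedRoot_step_mkOfModelCanonical` at each step).
* `exists_compatibleRootFamily_mkOfModelCanonical` — adding `hDSpull` ([FrdI] Prop. 4.1 (iii)), `hS` (Def. 4.1 (ii)) and the
  `H_A`-fixedness of `f`: a family `R N` (`N ≥ 1`) of `N`-th root data of any right fraction-pair `P` of `f` — `R N` lives on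
  `E_{N-1}` with root `g_{N-1}^{(N-1)!}` (`exists_rootData_of_node_mkOfModelCanonical`) — each `N`-domain in a skeleton through
  `A_⊙`, `μ_{l·N}`-saturated, with Def. 4.1 (iii)(a) at `l·N` (the three binders of this lineage's
  `pairIsNthRootOf_comp_mkOfModelCanonical`, p427648, as theorems), AND for all `N ∣ N′` the transition `α : A_{N′} → A_N` (of
  base-Frobenius type), `β : B_{N′} → B_N`, isometries of Frobenius degree `N′/N` with the two squares — by
  `exists_rootTransition_of_nthRoots_of_mul_eq_mkOfModelCanonical` along the chain composite `E_{N′-1} → E_{N-1}`, over which the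
  roots are compatible by the factorial bookkeeping `(N-1)!·(N′!/N!) = (N′-1)!·(N′/N)`.

HONEST FRAMING: kernel-checked consequences of the named base-level laws for data so typed; nothing asserts that such data exist
for an actual curve; no side is taken on [IUTchIII] Cor. 3.12; typed ≠ proved for the laws.
-/

noncomputable section

namespace Literature.AnabelianGeometry.EtaleTheta

open CategoryTheory Opposite Literature.AlgebraicGeometry.Frobenioids

universe u₀ v₀ u v w

namespace BiKummerSetting

section Canonical

variable {K : Type u₀} [Field K] (X : SemiGraphs.TemperedArithmeticGroup.{u₀} K) {D₀ : Type u₀}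
  [Category.{v₀} D₀] {V : FrdIMonoidStub.{w}} {T : RealifiedDivisorMonoids (D₀ := D₀) V}
  {D : Type u} [Category.{v} D] {VD : FrdICatStub.{u, v, w} D}
  (tf : TemperedFrobenioid T D VD) (hZ : tf.monoidType = MonoidType.Z)
  (hP : ∀ A : Dᵒᵖ, IsPerfect (tf.Φ.carrier A)) (IG : D → Prop) (gS : ∀ A : D, IG A → (X.Pi →* Aut A))
  (gSs : ∀ (A : D) (h : IG A), Function.Surjective (gS A h))
  (NH : Subgroup (Field.absoluteGaloisGroup K) → tf.category → ℕ+ → Prop) (A₀ : tf.category)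
  (hA₀ : PreFrobenioid.IsFrobeniusTrivial tf.toElem A₀) (hA₀' : IG A₀.base)
  (hΦd : Objectwise (fun M _ => IsDivisorial M) tf.divisorMonoid)

include hΦd in
/-- **A cofinal chain of coverings with coherent roots** (test statement): nodes `E_k → A` (`k ≥ 0`) with roots `g_k`,
`g_k^{(k+1)!} = φ_k^* f`, `μ_{l·(k+1)!}`-saturated, Def. 4.1 (iii)(a) at every level dividing `l·(k+1)!`, pairwise skeletal and
skeletal against `A_⊙` and `A`, linked by pull-back morphisms `ψ_k : E_{k+1} → E_k` with `φ_{k+1} = ψ_k ≫ φ_k` and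
`g_{k+1}^{k+2} = ψ_k^* g_k`.  [cite: MochizukiEtTh2009, Rmk 4.3.2 p.318–319 (PDF pp.92–93)] -/
theorem exists_rootChain_mkOfModelCanonical
    (hR : ∀ (N : ℕ+) (A : D), IG A → ∀ f : tf.ratFnFunctor.obj (op A),
      ∃ (A' : D) (_ : IG A') (b : A' ⟶ A) (g : tf.ratFnFunctor.obj (op A')),
        g ^ (N : ℕ) = pull tf.ratFnFunctor b f)
    (hEdiv : ∀ (M : ℕ+) (A' : tf.category), PreFrobenioid.IsFrobeniusTrivial tf.toElem A' → IG A'.base →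
      ∃ (A'' : tf.category) (ψ : A'' ⟶ A'), PreFrobenioid.IsPullbackMorphism tf.toElem ψ ∧ IG A''.base ∧
        tf.IsMuSaturated A'' M ∧
          ∀ N : ℕ+, (N : ℕ) ∣ (M : ℕ) → NH (mkOfModelCanonical X tf hZ hP IG gS gSs NH A₀ hA₀ hA₀').HodotBsFld A'' N)
    {A : tf.category} (hAft : PreFrobenioid.IsFrobeniusTrivial tf.toElem A) (hAG : IG A.base)
    (hskA : Nonempty (A.base ≅ A₀.base) → A = A₀) (f : tf.biratUnitsModel A) (lv : ℕ+) :
    ∃ (E : ℕ → tf.category) (φ : ∀ k, E k ⟶ A) (g : ∀ k, tf.biratUnitsModel (E k))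
      (ψ : ∀ k, E (k + 1) ⟶ E k),
      (∀ k, PreFrobenioid.IsPullbackMorphism tf.toElem (φ k)) ∧
      (∀ k, PreFrobenioid.IsFrobeniusTrivial tf.toElem (E k)) ∧ (∀ k, IG (E k).base) ∧
      (∀ k, g k ^ (k + 1).factorial = tf.pullFracModel (φ k) f) ∧
      (∀ k, tf.IsMuSaturated (E k) (lv * ⟨(k + 1).factorial, Nat.factorial_pos _⟩)) ∧
      (∀ k (N : ℕ+), (N : ℕ) ∣ (lv : ℕ) * (k + 1).factorial →
        ∃ (A₁ A₂ : tf.category) (s₁ : A₁ ⟶ E k) (s₂ : A₁ ⟶ A₂),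
          (mkOfModelCanonical X tf hZ hP IG gS gSs NH A₀ hA₀ hA₀').IsPreStep s₁ ∧
            (mkOfModelCanonical X tf hZ hP IG gS gSs NH A₀ hA₀ hA₀').IsPreStep s₂ ∧
              (mkOfModelCanonical X tf hZ hP IG gS gSs NH A₀ hA₀ hA₀').IsFrobeniusTrivial A₂ ∧
                (mkOfModelCanonical X tf hZ hP IG gS gSs NH A₀ hA₀ hA₀').IsNHSaturatedBsFld
                  (mkOfModelCanonical X tf hZ hP IG gS gSs NH A₀ hA₀ hA₀').HodotBsFld A₂ N) ∧
      (∀ k, Nonempty ((E k).base ≅ A₀.base) → E k = A₀) ∧ (∀ k, Nonempty ((E k).base ≅ A.base) → E k = A) ∧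
      (∀ k k', Nonempty ((E k).base ≅ (E k').base) → E k = E k') ∧
      (∀ k, PreFrobenioid.IsPullbackMorphism tf.toElem (ψ k)) ∧ (∀ k, φ (k + 1) = ψ k ≫ φ k) ∧
      (∀ k, g (k + 1) ^ (k + 2) = tf.pullFracModel (ψ k) (g k)) := by
  classical
  -- nodes: an object over `A` with a birational unit
  let Node := (E : tf.category) × ((E ⟶ A) × tf.biratUnitsModel E)
  let pre : Node := ⟨A, 𝟙 A, f⟩
  let NodeOK : Node → Prop := fun x => PreFrobenioid.IsFrobeniusTrivial tf.toElem x.1 ∧ IG x.1.base ∧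
    (Nonempty (x.1.base ≅ A₀.base) → x.1 = A₀) ∧ (Nonempty (x.1.base ≅ A.base) → x.1 = A)
  have preOK : NodeOK pre := ⟨hAft, hAG, hskA, fun _ => rfl⟩
  let cur : List Node → Node := fun L => L.headD pre
  -- the step: from a history `L` (current node = head) produce the next node
  have step : ∀ (k : ℕ) (L : List Node), ∃ y : Node, ((∀ x ∈ L, NodeOK x) ∧
      (∀ x ∈ L, ∀ x' ∈ L, Nonempty (x.1.base ≅ x'.1.base) → x.1 = x'.1)) →
      ∃ ψ : y.1 ⟶ (cur L).1, PreFrobenioid.IsPullbackMorphism tf.toElem ψ ∧ y.2.1 = ψ ≫ (cur L).2.1 ∧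
        y.2.2 ^ (k + 1) = tf.pullFracModel ψ (cur L).2.2 ∧ NodeOK y ∧
        tf.IsMuSaturated y.1 (lv * ⟨(k + 1).factorial, Nat.factorial_pos _⟩) ∧
        (∀ N : ℕ+, (N : ℕ) ∣ (lv : ℕ) * (k + 1).factorial →
          ∃ (A₁ A₂ : tf.category) (s₁ : A₁ ⟶ y.1) (s₂ : A₁ ⟶ A₂),
            (mkOfModelCanonical X tf hZ hP IG gS gSs NH A₀ hA₀ hA₀').IsPreStep s₁ ∧
              (mkOfModelCanonical X tf hZ hP IG gS gSs NH A₀ hA₀ hA₀').IsPreStep s₂ ∧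
                (mkOfModelCanonical X tf hZ hP IG gS gSs NH A₀ hA₀ hA₀').IsFrobeniusTrivial A₂ ∧
                  (mkOfModelCanonical X tf hZ hP IG gS gSs NH A₀ hA₀ hA₀').IsNHSaturatedBsFld
                    (mkOfModelCanonical X tf hZ hP IG gS gSs NH A₀ hA₀ hA₀').HodotBsFld A₂ N) ∧
        (∀ x ∈ L, Nonempty (y.1.base ≅ x.1.base) → y.1 = x.1) := by
    intro k L
    by_cases hinv : (∀ x ∈ L, NodeOK x) ∧ (∀ x ∈ L, ∀ x' ∈ L, Nonempty (x.1.base ≅ x'.1.base) → x.1 = x'.1)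
    · have hcurOK : NodeOK (cur L) := by
        cases L with
        | nil => exact preOK
        | cons a L' => exact hinv.1 a (List.mem_cons_self)
      -- the skeletal family: `A₀`, `A` and the nodes of `L`
      obtain ⟨E', ψ, g', hψ, hft', hG', hg', hμ', hc', hsk'⟩ :=
        exists_refinedRoot_step_mkOfModelCanonical X tf hZ hP IG gS gSs NH A₀ hA₀ hA₀' hΦd hR hEdiv hcurOK.1 hcurOK.2.1
          (cur L).2.2 ⟨k + 1, Nat.succ_pos k⟩ (lv * ⟨(k + 1).factorial, Nat.factorial_pos _⟩)
          (fun z => z = A₀ ∨ z = A ∨ ∃ x ∈ L, z = x.1)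
          (by
            rintro z (rfl | rfl | ⟨x, hx, rfl⟩)
            · exact hA₀
            · exact hAft
            · exact (hinv.1 x hx).1)
          (by
            rintro z (rfl | rfl | ⟨x, hx, rfl⟩)
            · exact hA₀'
            · exact hAG
            · exact (hinv.1 x hx).2.1)
          (by
            rintro z z' (rfl | rfl | ⟨x, hx, rfl⟩) (rfl | rfl | ⟨x', hx', rfl⟩) hne
            · rfl
            · exact (hskA ⟨(Classical.choice hne).symm⟩).symm
            · exact ((hinv.1 x' hx').2.2.1 ⟨(Classical.choice hne).symm⟩).symm
            · exact hskA hne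
            · rfl
            · exact ((hinv.1 x' hx').2.2.2 ⟨(Classical.choice hne).symm⟩).symm
            · exact (hinv.1 x hx).2.2.1 hne
            · exact (hinv.1 x hx).2.2.2 hne
            · exact hinv.2 x hx x' hx' hne)
      refine ⟨⟨E', ψ ≫ (cur L).2.1, g'⟩, fun _ => ⟨ψ, hψ, rfl, ?_, ⟨hft', hG', ?_, ?_⟩, hμ', ?_, ?_⟩⟩
      · simpa only [PNat.mk_coe] using hg'
      · exact fun hne => hsk' A₀ (Or.inl rfl) hne
      · exact fun hne => hsk' A (Or.inr (Or.inl rfl)) hne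
      · intro N hN
        exact hc' N (by simpa only [PNat.mul_coe, PNat.mk_coe] using hN)
      · intro x hx hne
        exact hsk' x.1 (Or.inr (Or.inr ⟨x, hx, rfl⟩)) hne
    · exact ⟨pre, fun h => (hinv h).elim⟩
  choose F hF using step
  -- the history and the invariant
  let hist : ℕ → List Node := fun k => Nat.rec [] (fun k L => F k L :: L) k
  have hist_succ : ∀ k, hist (k + 1) = F k (hist k) :: hist k := fun k => rfl
  have inv : ∀ k, (∀ x ∈ hist k, NodeOK x) ∧
      (∀ x ∈ hist k, ∀ x' ∈ hist k, Nonempty (x.1.base ≅ x'.1.base) → x.1 = x'.1) := by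
    intro k
    induction k with
    | zero => exact ⟨fun x hx => (List.not_mem_nil hx).elim, fun x hx => (List.not_mem_nil hx).elim⟩
    | succ k ih =>
      obtain ⟨ψ, -, -, -, hOK, -, -, hsk⟩ := hF k (hist k) ih
      rw [hist_succ]
      refine ⟨?_, ?_⟩
      · intro x hx
        rcases List.mem_cons.1 hx with hx | hx
        · rw [hx]; exact hOK
        · exact ih.1 x hx
      · intro x hx x' hx' hne
        rcases List.mem_cons.1 hx with hx | hx <;> rcases List.mem_cons.1 hx' with hx' | hx'
        · rw [hx, hx']
        · rw [hx] at hne ⊢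
          exact hsk x' hx' hne
        · rw [hx'] at hne ⊢
          exact (hsk x hx ⟨(Classical.choice hne).symm⟩).symm
        · exact ih.2 x hx x' hx' hne
  -- extract the chain
  have hprops := fun k => hF k (hist k) (inv k)
  choose ψ' hψpb hφeq hgeq hOK hμ hc hsk using hprops
  have hmem : ∀ n m, m < n → F m (hist m) ∈ hist n := by
    intro n
    induction n with
    | zero => intro m hm; exact (Nat.not_lt_zero m hm).elim
    | succ n ih =>
      intro m hm
      rw [hist_succ]
      rcases Nat.lt_succ_iff_lt_or_eq.1 hm with hm | rfl
      · exact List.mem_cons_of_mem _ (ih m hm)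
      · exact List.mem_cons_self
  -- pull-back property of `φ_k` and the root equation `g_k^{(k+1)!} = φ_k^* f`, by induction
  have hmain : ∀ k, PreFrobenioid.IsPullbackMorphism tf.toElem (F k (hist k)).2.1 ∧
      (F k (hist k)).2.2 ^ (k + 1).factorial = tf.pullFracModel (F k (hist k)).2.1 f := by
    intro k
    induction k with
    | zero =>
      refine ⟨?_, ?_⟩
      · rw [hφeq 0]
        exact PreFrobenioid.IsPullbackMorphism.comp _ (hψpb 0) (PreFrobenioid.isPullbackMorphism_of_isIso _ (𝟙 A))
      · have hg0 : (F 0 (hist 0)).2.2 = tf.pullFracModel (ψ' 0) f := by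
          have h := hgeq 0
          rw [zero_add, pow_one] at h
          exact h
        have hφ0 : (F 0 (hist 0)).2.1 = ψ' 0 ≫ 𝟙 A := hφeq 0
        rw [show Nat.factorial (0 + 1) = 1 from rfl, pow_one, hg0, hφ0]
        exact DFunLike.congr_fun (congrArg (fun χ => tf.pullFracModel χ) (Category.comp_id (ψ' 0)).symm) f
    | succ k ih =>
      refine ⟨?_, ?_⟩
      · rw [hφeq (k + 1)]
        exact PreFrobenioid.IsPullbackMorphism.comp _ (hψpb (k + 1)) ih.1
      · rw [Nat.factorial_succ (k + 1), pow_mul, hgeq (k + 1), ← map_pow, hφeq (k + 1), tf.pullFracModel_comp_apply]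
        exact congrArg _ ih.2
  refine ⟨fun k => (F k (hist k)).1, fun k => (F k (hist k)).2.1, fun k => (F k (hist k)).2.2, fun k => ψ' (k + 1),
    fun k => (hmain k).1, fun k => (hOK k).1, fun k => (hOK k).2.1, fun k => (hmain k).2, hμ, hc, fun k => (hOK k).2.2.1,
    fun k => (hOK k).2.2.2, ?_, fun k => hψpb (k + 1), fun k => hφeq (k + 1), fun k => hgeq (k + 1)⟩
  intro k k' hne
  exact (inv (max k k' + 1)).2 _ (hmem _ _ (Nat.lt_succ_of_le (le_max_left k k'))) _
    (hmem _ _ (Nat.lt_succ_of_le (le_max_right k k'))) hne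


include hΦd in
/-- **[EtTh] Rmk. 4.3.2 «by allowing `N` to vary, we obtain a compatible system of roots» — at the canonical model, from the
base-level laws**: for a Frobenius-trivial `A` with Galois base in a skeleton through `A_⊙`, `f ∈ O^×(A^birat)` fixed by `H_A` and a
right fraction-pair `P` of `f`, there is a FAMILY `R N` (`N ≥ 1`) of `N`-th root data of `P` — `R N` living on the node `E_{N-1}` of
a chain of coverings with coherent roots (`exists_rootChain_mkOfModelCanonical`), root `g_{N-1}^{(N-1)!}` — each with its `N`-domain
in a skeleton through `A_⊙`, `μ_{l·N}`-saturated and satisfying Def. 4.1 (iii)(a) at level `l·N` (the inputs of this lineage's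
`pairIsNthRootOf_comp_mkOfModelCanonical`, p427648), TOGETHER WITH the Rmk. 4.3.2 transitions for ALL `N ∣ N′` in the field
shapes of abc-iut-L2-t4's `ThetaFrobenioidTower.ofBiKummerFamily` (`α`, `β`, the two squares, isometries, `deg·N = N′`,
`α` of base-Frobenius type) — by `exists_rootTransition_of_nthRoots_of_mul_eq_mkOfModelCanonical` along the chain composites,
over which the roots are compatible ON THE NOSE.  Laws: `Φ` divisorial, `hDSpull`, `hR` (G-w4d044-3), `hEdiv` (G-w5d134g4-1,
family form), `hS`.  [cite: MochizukiEtTh2009, Rmk 4.3.2 p.318–319 (PDF pp.92–93)] -/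
theorem exists_compatibleRootFamily_mkOfModelCanonical
    (hDSpull : ∀ {A A' : D} (e : A' ⟶ A) {a b : tf.Φ.carrier (op A)},
      (∀ x : tf.Φ.carrier (op A), x ∣ a → x ∣ b → x = 1) →
        ∀ y : tf.Φ.carrier (op A'), y ∣ pull tf.divisorMonoid e a → y ∣ pull tf.divisorMonoid e b → y = 1)
    (hR : ∀ (N : ℕ+) (A : D), IG A → ∀ f : tf.ratFnFunctor.obj (op A),
      ∃ (A' : D) (_ : IG A') (b : A' ⟶ A) (g : tf.ratFnFunctor.obj (op A')),
        g ^ (N : ℕ) = pull tf.ratFnFunctor b f)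
    (hEdiv : ∀ (M : ℕ+) (A' : tf.category), PreFrobenioid.IsFrobeniusTrivial tf.toElem A' → IG A'.base →
      ∃ (A'' : tf.category) (ψ : A'' ⟶ A'), PreFrobenioid.IsPullbackMorphism tf.toElem ψ ∧ IG A''.base ∧
        tf.IsMuSaturated A'' M ∧
          ∀ N : ℕ+, (N : ℕ) ∣ (M : ℕ) → NH (mkOfModelCanonical X tf hZ hP IG gS gSs NH A₀ hA₀ hA₀').HodotBsFld A'' N)
    (hS : ∀ ⦃A B : D⦄ (hA : IG A) (hB : IG B) (b : B ⟶ A),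
      ∃ c : X.Pi, ∀ g : X.Pi, (gS B hB g).hom ≫ b = b ≫ (gS A hA (c * g * c⁻¹)).hom)
    {A B : tf.category} (hAft : PreFrobenioid.IsFrobeniusTrivial tf.toElem A) (hAG : IG A.base)
    (hskA : Nonempty (A.base ≅ A₀.base) → A = A₀)
    {f : tf.biratUnitsModel A} (hfix : (mkOfModelCanonical X tf hZ hP IG gS gSs NH A₀ hA₀ hA₀').IsFixedByHA A hAG f)
    (P : (mkOfModelCanonical X tf hZ hP IG gS gSs NH A₀ hA₀ hA₀').FractionPair f B) (lv : ℕ+) :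
    ∃ R : ∀ N : ℕ+, (mkOfModelCanonical X tf hZ hP IG gS gSs NH A₀ hA₀ hA₀').NthRoot f P N (fun {_} φ x => tf.pullFracModel φ x),
      (∀ N : ℕ+, (Nonempty ((R N).AN.base ≅ A₀.base) → (R N).AN = A₀) ∧ tf.IsMuSaturated (R N).AN (lv * N) ∧
        ∃ (A₁ A₂ : tf.category) (s₁ : A₁ ⟶ (R N).AN) (s₂ : A₁ ⟶ A₂),
          (mkOfModelCanonical X tf hZ hP IG gS gSs NH A₀ hA₀ hA₀').IsPreStep s₁ ∧
            (mkOfModelCanonical X tf hZ hP IG gS gSs NH A₀ hA₀ hA₀').IsPreStep s₂ ∧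
              (mkOfModelCanonical X tf hZ hP IG gS gSs NH A₀ hA₀ hA₀').IsFrobeniusTrivial A₂ ∧
                (mkOfModelCanonical X tf hZ hP IG gS gSs NH A₀ hA₀ hA₀').IsNHSaturatedBsFld
                  (mkOfModelCanonical X tf hZ hP IG gS gSs NH A₀ hA₀ hA₀').HodotBsFld A₂ (lv * N)) ∧
      ∀ (N N' : ℕ+), (N : ℕ) ∣ (N' : ℕ) → ∃ (α : (R N').AN ⟶ (R N).AN) (β : (R N').BN ⟶ (R N).BN),
        (R N').pair.num ≫ β = α ≫ (R N).pair.num ∧ (R N').pair.den ≫ β = α ≫ (R N).pair.den ∧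
          (mkOfModelCanonical X tf hZ hP IG gS gSs NH A₀ hA₀ hA₀').IsIsometry α ∧
            ((mkOfModelCanonical X tf hZ hP IG gS gSs NH A₀ hA₀ hA₀').degFr α : ℕ) * N = N' ∧
              (mkOfModelCanonical X tf hZ hP IG gS gSs NH A₀ hA₀ hA₀').IsIsometry β ∧
                ((mkOfModelCanonical X tf hZ hP IG gS gSs NH A₀ hA₀ hA₀').degFr β : ℕ) * N = N' ∧
                  (mkOfModelCanonical X tf hZ hP IG gS gSs NH A₀ hA₀ hA₀').IsOfBaseFrobeniusType α := by
  classical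
  obtain ⟨E, φ, g, ψ, hφpb, hft, hG, hroot, hμ, hc, hsk0, hsk1, hskE, hψpb, hφsucc, hgsucc⟩ :=
    exists_rootChain_mkOfModelCanonical X tf hZ hP IG gS gSs NH A₀ hA₀ hA₀' hΦd hR hEdiv hAft hAG hskA f lv
  -- composites along the chain and their exponents
  let comp : ∀ k j : ℕ, E (k + j) ⟶ E k := fun k j =>
    Nat.rec (motive := fun j => E (k + j) ⟶ E k) (𝟙 (E k)) (fun j c => ψ (k + j) ≫ c) j
  let ex : ℕ → ℕ → ℕ := fun k j => Nat.rec (motive := fun _ => ℕ) 1 (fun j e => e * (k + j + 2)) j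
  have comp_succ : ∀ k j, comp k (j + 1) = ψ (k + j) ≫ comp k j := fun k j => rfl
  have ex_succ : ∀ k j, ex k (j + 1) = ex k j * (k + j + 2) := fun k j => rfl
  have hex : ∀ k j, (k + 1).factorial * ex k j = (k + j + 1).factorial := by
    intro k j
    induction j with
    | zero => exact Nat.mul_one _
    | succ j ih =>
      have e : k + (j + 1) + 1 = (k + j + 1) + 1 := by omega
      rw [ex_succ, ← mul_assoc, ih, e, Nat.factorial_succ (k + j + 1)]
      ring
  have hcomp : ∀ k j, PreFrobenioid.IsPullbackMorphism tf.toElem (comp k j) ∧ φ (k + j) = comp k j ≫ φ k ∧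
      g (k + j) ^ ex k j = tf.pullFracModel (comp k j) (g k) := by
    intro k j
    induction j with
    | zero =>
      refine ⟨PreFrobenioid.isPullbackMorphism_of_isIso _ (𝟙 (E k)), (Category.id_comp _).symm, ?_⟩
      change g k ^ 1 = tf.pullFracModel (𝟙 (E k)) (g k)
      rw [pow_one]
      apply Units.ext
      rw [TemperedFrobenioid.coe_pullFracModel_apply, ModelFrobenioid.baseMap_id, op_id, CategoryTheory.Functor.map_id]
      rfl
    | succ j ih =>
      refine ⟨PreFrobenioid.IsPullbackMorphism.comp _ (hψpb (k + j)) ih.1, ?_, ?_⟩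
      · rw [comp_succ, Category.assoc, ← ih.2.1]
        exact hφsucc (k + j)
      · show g (k + j + 1) ^ ex k (j + 1) = tf.pullFracModel (comp k (j + 1)) (g k)
        rw [ex_succ, pow_mul', hgsucc (k + j), ← map_pow, ih.2.2, comp_succ, tf.pullFracModel_comp_apply]
  -- the root data on the node `E_{N-1}`: root `g_{N-1}^{(N-1)!}`
  have hdivN : ∀ N : ℕ+, (N : ℕ) ∣ (lv : ℕ) * (N.natPred + 1).factorial := fun N => by
    rw [PNat.natPred_add_one]
    exact Dvd.dvd.mul_left (Nat.dvd_factorial N.pos le_rfl) _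
  have hdivlN : ∀ N : ℕ+, ((lv * N : ℕ+) : ℕ) ∣ (lv : ℕ) * (N.natPred + 1).factorial := fun N => by
    rw [PNat.mul_coe, PNat.natPred_add_one]
    exact Nat.mul_dvd_mul_left _ (Nat.dvd_factorial N.pos le_rfl)
  have hgN : ∀ N : ℕ+, (g N.natPred ^ N.natPred.factorial) ^ (N : ℕ) = tf.pullFracModel (φ N.natPred) f := by
    intro N
    calc (g N.natPred ^ N.natPred.factorial) ^ (N : ℕ)
        = g N.natPred ^ (N.natPred.factorial * (N.natPred + 1)) := by rw [← pow_mul, PNat.natPred_add_one]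
      _ = g N.natPred ^ (N.natPred + 1).factorial := by rw [Nat.factorial_succ, mul_comm]
      _ = tf.pullFracModel (φ N.natPred) f := hroot N.natPred
  have hRD := fun N : ℕ+ => exists_rootData_of_node_mkOfModelCanonical X tf hZ hP IG gS gSs NH A₀ hA₀ hA₀' hΦd hDSpull
    hS hAft hAG hfix P N (φ N.natPred) (hφpb _) (hft _) (hG _) (hsk1 _)
    ((hμ N.natPred).of_dvd (by rw [PNat.mul_coe, PNat.mk_coe]; exact hdivN N)) (hc _ N (hdivN N)) (hgN N)
  choose BNf Qf αf βf df hiso hβiso hdeg hβdeg hcn hcd hb₁ hg hsat using hRD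
  let R : ∀ N : ℕ+, (mkOfModelCanonical X tf hZ hP IG gS gSs NH A₀ hA₀ hA₀').NthRoot f P N
      (fun {_} φ x => tf.pullFracModel φ x) := fun N =>
    { AN := E N.natPred, BN := BNf N, α := αf N, β := βf N, root := g N.natPred ^ N.natPred.factorial, pair := Qf N,
      comm_num := hcn N, comm_den := hcd N, isIsometry := ⟨hiso N, hβiso N, hdeg N, hβdeg N⟩, αData := df N,
      pow_root := hg N, isSaturated := hsat N }
  refine ⟨R, fun N => ⟨hsk0 _, ?_, ?_⟩, ?_⟩
  · exact (hμ N.natPred).of_dvd (by simp only [PNat.mul_coe, PNat.mk_coe]; exact hdivlN N)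
  · exact hc _ (lv * N) (hdivlN N)
  · -- the transitions `N ∣ N'` along the chain composite `E_{N'-1} → E_{N-1}`
    intro N N' hd
    obtain ⟨k, rfl⟩ : ∃ k : ℕ, N = k.succPNat := ⟨N.natPred, (PNat.succPNat_natPred N).symm⟩
    obtain ⟨m, hm⟩ := hd
    have hm1 : (N' : ℕ) = (k + 1) * m := by rw [hm, Nat.succPNat_coe]
    have hm0 : 0 < m := by
      rcases Nat.eq_zero_or_pos m with h0 | h0
      · exfalso
        rw [h0, mul_zero] at hm1
        exact PNat.ne_zero N' hm1
      · exact h0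
    have hle : k + 1 ≤ (N' : ℕ) := by
      rw [hm1]
      exact Nat.le_mul_of_pos_right _ hm0
    obtain ⟨j, hj⟩ : ∃ j : ℕ, (N' : ℕ) = k + j + 1 := ⟨(N' : ℕ) - (k + 1), by omega⟩
    have hN' : N' = (k + j).succPNat := PNat.eq (by rw [Nat.succPNat_coe]; omega)
    subst hN'
    have hm' : k + j + 1 = (k + 1) * m := by rw [← hm1, Nat.succPNat_coe]
    let M : ℕ+ := ⟨m, hm0⟩
    have hMc : (M : ℕ) = m := rfl
    have hM : M * k.succPNat = (k + j).succPNat :=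
      PNat.eq (by rw [PNat.mul_coe, hMc, Nat.succPNat_coe, Nat.succPNat_coe, Nat.succ_eq_add_one, Nat.succ_eq_add_one, hm',
        Nat.mul_comm])
    -- root compatibility along the composite: `(g_{k+j}^{(k+j)!})^m = comp^*(g_k^{k!})`
    have hexp : (k + j).factorial * m = ex k j * k.factorial := by
      apply Nat.eq_of_mul_eq_mul_left (Nat.succ_pos k)
      calc (k + 1) * ((k + j).factorial * m) = (k + j).factorial * ((k + 1) * m) := by ring
        _ = (k + j).factorial * (k + j + 1) := by rw [← hm']
        _ = (k + j + 1).factorial := by rw [Nat.factorial_succ (k + j)]; ring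
        _ = (k + 1).factorial * ex k j := (hex k j).symm
        _ = (k + 1) * (ex k j * k.factorial) := by rw [Nat.factorial_succ k]; ring
    have hg' : (g (k + j) ^ (k + j).factorial) ^ (M : ℕ) = tf.pullFracModel (comp k j) (g k ^ k.factorial) := by
      rw [hMc, map_pow, ← (hcomp k j).2.2, ← pow_mul, ← pow_mul, hexp]
    have hb' : ModelFrobenioid.baseMap (df (k + j).succPNat).α₁ =
        ModelFrobenioid.baseMap (comp k j) ≫ ModelFrobenioid.baseMap (df k.succPNat).α₁ := by
      rw [hb₁, hb₁]
      show ModelFrobenioid.baseMap (φ (k + j)) = ModelFrobenioid.baseMap (comp k j) ≫ ModelFrobenioid.baseMap (φ k)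
      rw [(hcomp k j).2.1, ModelFrobenioid.baseMap_comp]
    obtain ⟨α, β, h1, h2, h3, h4, h5, h6, h7, -⟩ :=
      exists_rootTransition_of_nthRoots_of_mul_eq_mkOfModelCanonical X tf hZ hP IG gS gSs NH A₀ hA₀ hA₀' hΦd
        (R k.succPNat) (R (k + j).succPNat) M hM (comp k j) (hcomp k j).1 hb' hg' (hskE _ _)
    exact ⟨α, β, h1, h2, h3, h4, h5, h6, h7⟩

end Canonical

end BiKummerSetting

end Literature.AnabelianGeometry.EtaleTheta

end
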